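import Summits.AnomalousDissipation.AnomalousDissipation.Theorems.TaylorCertificatesSteadyStatesLoudBoundedStubDodgerAssemblyHelpers
import Summits.AnomalousDissipation.AnomalousDissipation.Theorems.TaylorCertificatesSteadyStatesLoudBoundedStubDodgerAssemblyHelpers2
import Literature.Analysis.FluidPDE.SteadyNavierStokesEnergy
import Literature.Analysis.FunctionSpaces.TorusFourierModes
import Literature.Analysis.FunctionSpaces.TorusFluidGlueProofs

/-!
# Stub `stub_dodgerAssembly` of line lojasiewicz-lamb-floor-ladder (crux stmt-AnomalousDissipation-13038)

**S4b of the line: the Onsager dodger built from Fourier truncations plus a shear wiggle**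
(crux `TaylorCertificates.SteadyStatesLoudBounded`, route file `Theses/TaylorCertificates.lean`).
Given a finite-enstrophy field `U ∈ V` strictly inside the energy ball, `‖U‖² < E`, a smooth
force `f`, and residual bounds `r_N → 0` (dual norm over the smooth divergence-free mean-zero
test class) for the steady-Euler residuals of the truncations `P_N U = Torus.fourierTruncate N U`
(the conclusion of the neighbouring stub S4a, taken here as a hypothesis), we construct a
*bad sequence with divergent enstrophy* at level `E`:

  `u_n := P_{N_n} U + a_n • W_{M_n}`,  `W_M (x) = √2 cos(2π M x₀) e₁`,

with `r_{N_n} ≤ 1/(n+1)²`, `M_n := max (N_n + 1) (n+1)³`, `a_n := min ((n+1)/M_n) √((E−‖U‖²)/2)`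
(`dodger_parameters`).  The wiggle enters only through the sub-goal `dodgerAssembly_partA`
(part 1: admissible, `‖W‖ ≤ √2`, `(W·∇)W = 0`, `∫‖W‖² = 1`, `‖∇W‖² = 4π²M²`, Fourier support
`|k|² = M²`), so for `M_n > N_n` the truncation and the wiggle have disjoint Fourier supports and
are `L²`- and `Ḣ¹`-orthogonal (part 2): `∫‖u_n‖² = ∫‖P_N U‖² + a_n² ≤ ‖U‖² + (E − ‖U‖²)/2 ≤ E`
(Bessel) and `‖∇u_n‖₂² = ‖∇P_N U‖₂² + 4π² (a_n M_n)² ∈ [4π² (a_n M_n)², ‖∇U‖₂² + 4π² (a_n M_n)²]`.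
The residual of `u_n` is bounded through the sub-goal `dodgerAssembly_partB` (part 2: the `a_n²`
term `(W·∇)W` vanishes, the cross terms are bounded by antisymmetry of the trilinear form and
Cauchy–Schwarz) by `R_n := r_{N_n} + 2√2√3 ‖U‖ a_n`, and `dodger_rates` turns the window
`(n+1) min(1, c₀) ≤ a_n M_n ≤ n+1` into `R_n → 0`, `R_n ‖∇u_n‖₂ ≤ (1 + 2√6‖U‖)(‖∇U‖₂ + 2π)/(n+1) → 0`
and `‖∇u_n‖₂² → ∞`.

Helper files (same namespace): `TaylorCertificatesSteadyStatesLoudBoundedStubDodgerAssemblyHelpers.lean`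
(the wiggle, sub-goal `dodgerAssembly_partA`) and `…Helpers2.lean` (linear glue, residual identity,
sub-goal `dodgerAssembly_partB`, disjoint-support orthogonality, truncation bookkeeping).
-/

-- `Summit.<Summit>.<Problem>` is the tree's mandated summit-side namespace (CONVENTIONS §2); for this
-- single-conjunct summit the two coincide, so the duplicate is deliberate.
set_option linter.dupNamespace false

noncomputable section

namespace Summit.AnomalousDissipation.AnomalousDissipation.Theorems.SteadyStatesLoudBounded.DodgerAssembly

open MeasureTheory Filter Topology UnitAddTorus
open scoped InnerProductSpace ENNReal
open Literature.Analysis.FunctionSpaces Literature.Analysis.FluidPDE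

/-! ## §1 The parameters of the dodger and its rates (pure real bookkeeping) -/

/-- **Choice of wiggle frequencies and amplitudes.** Given truncation orders `N n` and `c₀ > 0`,
`M n := max (N n + 1) (n+1)³` and `a n := min ((n+1)/M n) c₀` satisfy `N n < M n`,
`0 < a n ≤ min c₀ (1/(n+1)²)` and `(n+1) min(1,c₀) ≤ a n M n ≤ n+1`. [folklore] -/
theorem dodger_parameters (N : ℕ → ℕ) {c₀ : ℝ} (hc₀ : 0 < c₀) :
    ∃ (M : ℕ → ℕ) (a : ℕ → ℝ), ∀ n : ℕ, N n < M n ∧ 0 < a n ∧ a n ≤ c₀ ∧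
      a n ≤ 1 / ((n : ℝ) + 1) ^ 2 ∧ a n * M n ≤ (n : ℝ) + 1 ∧
      ((n : ℝ) + 1) * min 1 c₀ ≤ a n * M n := by
  refine ⟨fun n => max (N n + 1) ((n + 1) ^ 3),
    fun n => min (((n : ℝ) + 1) / ((max (N n + 1) ((n + 1) ^ 3) : ℕ) : ℝ)) c₀, fun n => ?_⟩
  set M : ℕ := max (N n + 1) ((n + 1) ^ 3) with hM
  have hn1 : (1 : ℝ) ≤ (n : ℝ) + 1 := by
    have := Nat.cast_nonneg (α := ℝ) n
    linarith
  have hMge : ((n : ℝ) + 1) ^ 3 ≤ (M : ℝ) := by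
    have h : (n + 1) ^ 3 ≤ M := le_max_right _ _
    exact_mod_cast h
  have hMge1 : (n : ℝ) + 1 ≤ (M : ℝ) := (le_self_pow₀ hn1 three_ne_zero).trans hMge
  have hMpos : (0 : ℝ) < M := lt_of_lt_of_le (by positivity) hMge1
  refine ⟨lt_of_lt_of_le (Nat.lt_succ_self _) (le_max_left _ _),
    lt_min (div_pos (by positivity) hMpos) hc₀, min_le_right _ _, ?_, ?_, ?_⟩
  · refine (min_le_left _ _).trans ?_
    rw [div_le_div_iff₀ hMpos (by positivity), one_mul]
    calc ((n : ℝ) + 1) * ((n : ℝ) + 1) ^ 2 = ((n : ℝ) + 1) ^ 3 := by ring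
      _ ≤ (M : ℝ) := hMge
  · calc min (((n : ℝ) + 1) / (M : ℝ)) c₀ * M ≤ ((n : ℝ) + 1) / (M : ℝ) * M :=
          mul_le_mul_of_nonneg_right (min_le_left _ _) hMpos.le
      _ = (n : ℝ) + 1 := div_mul_cancel₀ _ hMpos.ne'
  · rw [min_mul_of_nonneg _ _ hMpos.le, div_mul_cancel₀ _ hMpos.ne']
    refine le_min ?_ ?_
    · calc ((n : ℝ) + 1) * min 1 c₀ ≤ ((n : ℝ) + 1) * 1 :=
            mul_le_mul_of_nonneg_left (min_le_left _ _) (by positivity)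
        _ = (n : ℝ) + 1 := mul_one _
    · calc ((n : ℝ) + 1) * min 1 c₀ ≤ ((n : ℝ) + 1) * c₀ :=
            mul_le_mul_of_nonneg_left (min_le_right _ _) (by positivity)
        _ ≤ (M : ℝ) * c₀ := mul_le_mul_of_nonneg_right hMge1 hc₀.le
        _ = c₀ * M := mul_comm _ _

/-- **Rates of the dodger.** If `0 ≤ ρ n ≤ 1/(n+1)²`, `0 < a n ≤ 1/(n+1)²`,
`(n+1) m₀ ≤ p n ≤ n+1` (`m₀ > 0`), `C, G_U ≥ 0`, and the enstrophies `G n` lie in the window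
`[4π² (p n)², G_U + 4π² (p n)²]`, then `R n := ρ n + 2 C a n ≥ 0` tends to `0`, the virtual
dissipation `R n √(G n) ≤ (1 + 2C)(√G_U + 2π)/(n+1)` tends to `0`, and `G n → ∞`. [folklore] -/
theorem dodger_rates {ρ a p G : ℕ → ℝ} {C GU m₀ : ℝ} (hC : 0 ≤ C) (hGU : 0 ≤ GU) (hm₀ : 0 < m₀)
    (hρ0 : ∀ n, 0 ≤ ρ n) (hρ : ∀ n : ℕ, ρ n ≤ 1 / ((n : ℝ) + 1) ^ 2) (ha0 : ∀ n, 0 < a n)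
    (ha : ∀ n : ℕ, a n ≤ 1 / ((n : ℝ) + 1) ^ 2) (hp : ∀ n : ℕ, p n ≤ (n : ℝ) + 1)
    (hp' : ∀ n : ℕ, ((n : ℝ) + 1) * m₀ ≤ p n) (hGlo : ∀ n, 4 * Real.pi ^ 2 * p n ^ 2 ≤ G n)
    (hGhi : ∀ n, G n ≤ GU + 4 * Real.pi ^ 2 * p n ^ 2) :
    (∀ n, 0 ≤ ρ n + 2 * C * a n) ∧ Tendsto (fun n => ρ n + 2 * C * a n) atTop (𝓝 0) ∧
      Tendsto (fun n => (ρ n + 2 * C * a n) * Real.sqrt (G n)) atTop (𝓝 0) ∧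
      ∀ B : ℝ, ∃ N₀ : ℕ, ∀ n : ℕ, N₀ ≤ n → B < G n := by
  set ε : ℕ → ℝ := fun n => 1 / ((n : ℝ) + 1) with hεdef
  have hn1 : ∀ n : ℕ, (1 : ℝ) ≤ (n : ℝ) + 1 := fun n => by
    have := Nat.cast_nonneg (α := ℝ) n
    linarith
  have hε0 : ∀ n : ℕ, 0 < ε n := fun n => by positivity
  have hε1 : ∀ n : ℕ, ε n ≤ 1 := fun n => (div_le_one (by positivity)).2 (hn1 n)
  have hεn : ∀ n : ℕ, ε n * ((n : ℝ) + 1) = 1 := fun n => one_div_mul_cancel (by positivity)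
  have hR0 : ∀ n : ℕ, 0 ≤ ρ n + 2 * C * a n := fun n =>
    add_nonneg (hρ0 n) (by have := ha0 n; positivity)
  have hRle2 : ∀ n : ℕ, ρ n + 2 * C * a n ≤ (1 + 2 * C) * ε n ^ 2 := fun n => by
    have h2 : ρ n ≤ ε n ^ 2 := by
      have h := hρ n
      rwa [← one_div_pow] at h
    have h3 : a n ≤ ε n ^ 2 := by
      have h := ha n
      rwa [← one_div_pow] at h
    nlinarith
  have hRle : ∀ n : ℕ, ρ n + 2 * C * a n ≤ (1 + 2 * C) * ε n := fun n =>
    (hRle2 n).trans (mul_le_mul_of_nonneg_left (by nlinarith [hε0 n, hε1 n]) (by positivity))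
  have hsqrtG : ∀ n : ℕ, Real.sqrt (G n) ≤ Real.sqrt GU + 2 * Real.pi * ((n : ℝ) + 1) := fun n => by
    have ht : 0 ≤ 2 * Real.pi * ((n : ℝ) + 1) := by positivity
    refine Real.sqrt_le_iff.2 ⟨by positivity, ?_⟩
    have hGU' : Real.sqrt GU ^ 2 = GU := Real.sq_sqrt hGU
    have hp0 : 0 ≤ p n := le_trans (by positivity) (hp' n)
    have hsq : p n ^ 2 ≤ ((n : ℝ) + 1) ^ 2 := pow_le_pow_left₀ hp0 (hp n) 2
    calc G n ≤ GU + 4 * Real.pi ^ 2 * p n ^ 2 := hGhi n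
      _ ≤ GU + 4 * Real.pi ^ 2 * ((n : ℝ) + 1) ^ 2 := by nlinarith [Real.pi_pos]
      _ ≤ (Real.sqrt GU + 2 * Real.pi * ((n : ℝ) + 1)) ^ 2 := by
          nlinarith [mul_nonneg (Real.sqrt_nonneg GU) ht]
  have hεlim : Tendsto ε atTop (𝓝 0) := tendsto_one_div_add_atTop_nhds_zero_nat
  refine ⟨hR0, ?_, ?_, ?_⟩
  · have hlim : Tendsto (fun n : ℕ => (1 + 2 * C) * ε n) atTop (𝓝 0) := by
      simpa using hεlim.const_mul (1 + 2 * C)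
    exact squeeze_zero hR0 hRle hlim
  · set K : ℝ := (1 + 2 * C) * (Real.sqrt GU + 2 * Real.pi) with hK
    have hle : ∀ n : ℕ, (ρ n + 2 * C * a n) * Real.sqrt (G n) ≤ K * ε n := fun n => by
      have hA : (ρ n + 2 * C * a n) * Real.sqrt (G n) ≤
          (1 + 2 * C) * ε n ^ 2 * (Real.sqrt GU + 2 * Real.pi * ((n : ℝ) + 1)) :=
        mul_le_mul (hRle2 n) (hsqrtG n) (Real.sqrt_nonneg _) (by positivity)
      have hB : (1 + 2 * C) * ε n ^ 2 * (Real.sqrt GU + 2 * Real.pi * ((n : ℝ) + 1)) =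
          (1 + 2 * C) * (ε n * (ε n * Real.sqrt GU) + 2 * Real.pi * (ε n * (ε n * ((n : ℝ) + 1)))) := by
        ring
      have hD : ε n * Real.sqrt GU ≤ Real.sqrt GU := mul_le_of_le_one_left (Real.sqrt_nonneg _) (hε1 n)
      rw [hεn n] at hB
      calc (ρ n + 2 * C * a n) * Real.sqrt (G n)
          ≤ (1 + 2 * C) * ε n ^ 2 * (Real.sqrt GU + 2 * Real.pi * ((n : ℝ) + 1)) := hA
        _ = (1 + 2 * C) * (ε n * (ε n * Real.sqrt GU) + 2 * Real.pi * (ε n * 1)) := hB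
        _ ≤ (1 + 2 * C) * (ε n * Real.sqrt GU + 2 * Real.pi * (ε n * 1)) :=
            mul_le_mul_of_nonneg_left (add_le_add (mul_le_mul_of_nonneg_left hD (hε0 n).le) le_rfl)
              (by positivity)
        _ = K * ε n := by rw [hK]; ring
    have hlim : Tendsto (fun n : ℕ => K * ε n) atTop (𝓝 0) := by
      simpa using hεlim.const_mul K
    exact squeeze_zero (fun n => mul_nonneg (hR0 n) (Real.sqrt_nonneg _)) hle hlim
  · intro B
    obtain ⟨N₀, hN₀⟩ := exists_nat_gt (B / m₀ ^ 2)
    refine ⟨N₀, fun n hn => ?_⟩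
    have hm2 : 0 < m₀ ^ 2 := by positivity
    have hB : B < (N₀ : ℝ) * m₀ ^ 2 := (div_lt_iff₀ hm2).1 hN₀
    have hπ : 1 ≤ 4 * Real.pi ^ 2 := by nlinarith [Real.pi_gt_three]
    have hn' : (N₀ : ℝ) ≤ n := by exact_mod_cast hn
    calc B < (N₀ : ℝ) * m₀ ^ 2 := hB
      _ ≤ ((n : ℝ) + 1) ^ 2 * m₀ ^ 2 := by
          refine mul_le_mul_of_nonneg_right ?_ hm2.le
          nlinarith [hn', Nat.cast_nonneg (α := ℝ) n]
      _ = 1 * (((n : ℝ) + 1) * m₀) ^ 2 := by ring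
      _ ≤ 4 * Real.pi ^ 2 * p n ^ 2 := by
          refine mul_le_mul hπ ?_ (sq_nonneg _) (by positivity)
          exact pow_le_pow_left₀ (by positivity) (hp' n) 2
      _ ≤ G n := hGlo n

/-! ## §2 The registered stub -/

/-- **S4b `stub_dodgerAssembly`** — THE DODGER BUILT FROM TRUNCATIONS PLUS A SHEAR WIGGLE.
Given `U ∈ V` with `‖U‖² < E` and residual bounds `r_N → 0` for its Fourier truncations
`P_N U` (the conclusion of S4a), the fields `u_n := P_{N_n} U + a_n • W_{M_n}` — with
`r_{N_n} ≤ 1/(n+1)²`, `(M_n, a_n)` from `dodger_parameters` with `c₀ = √((E − ‖U‖²)/2)`, and the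
shear wiggles `W_M` of `dodgerAssembly_partA` — form a bad sequence at level `E` (admissible,
energy `∫‖P_N U‖² + a_n² ≤ E`, residual bounds `R_n := r_{N_n} + 2√2√3 ‖U‖ a_n` by
`dodgerAssembly_partB`) whose enstrophy `‖∇P_N U‖² + 4π² (a_n M_n)²` obeys `dodger_rates`:
`R_n → 0`, `R_n ‖∇u_n‖₂ → 0`, `‖∇u_n‖₂² → ∞`. [folklore] -/
theorem stub_dodgerAssembly :
    ∀ (f : UnitAddTorus (Fin 3) → EuclideanSpace ℝ (Fin 3)) (E : ℝ) (U : Torus.energySpace (Fin 3)), Torus.IsSmooth f →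
      (U : Lp (EuclideanSpace ℝ (Fin 3)) 2 (volume : Measure (UnitAddTorus (Fin 3)))) ∈ Torus.energySpaceV (Fin 3) →
      ‖U‖ ^ 2 < E →
      (∃ r : ℕ → ℝ, (∀ N : ℕ, 0 ≤ r N) ∧ Tendsto r atTop (𝓝 0) ∧
        ∀ (N : ℕ) (w : UnitAddTorus (Fin 3) → EuclideanSpace ℝ (Fin 3)),
          Torus.IsSmooth w → Torus.IsDivFree w → Torus.HasZeroMean w →
          |∫ x, inner ℝ (Torus.convect
              (Torus.fourierTruncate N
                ((U : Lp (EuclideanSpace ℝ (Fin 3)) 2 (volume : Measure (UnitAddTorus (Fin 3)))) :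
                  UnitAddTorus (Fin 3) → EuclideanSpace ℝ (Fin 3)))
              (Torus.fourierTruncate N
                ((U : Lp (EuclideanSpace ℝ (Fin 3)) 2 (volume : Measure (UnitAddTorus (Fin 3)))) :
                  UnitAddTorus (Fin 3) → EuclideanSpace ℝ (Fin 3))) x - f x) (w x)| ≤
            r N * Real.sqrt (Torus.gradNormSq w)) →
      ∃ (u : ℕ → UnitAddTorus (Fin 3) → EuclideanSpace ℝ (Fin 3)) (R : ℕ → ℝ),
        (∀ n : ℕ, Torus.IsSmooth (u n) ∧ Torus.IsDivFree (u n) ∧ Torus.HasZeroMean (u n) ∧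
          ∫ x, ‖u n x‖ ^ 2 ≤ E ∧ 0 ≤ R n ∧
          ∀ w : UnitAddTorus (Fin 3) → EuclideanSpace ℝ (Fin 3),
            Torus.IsSmooth w → Torus.IsDivFree w → Torus.HasZeroMean w →
            |∫ x, inner ℝ (Torus.convect (u n) (u n) x - f x) (w x)| ≤ R n * Real.sqrt (Torus.gradNormSq w)) ∧
        Tendsto R atTop (𝓝 0) ∧
        Tendsto (fun n => R n * Real.sqrt (Torus.gradNormSq (u n))) atTop (𝓝 0) ∧
        ∀ B : ℝ, ∃ N : ℕ, ∀ n : ℕ, N ≤ n → B < Torus.gradNormSq (u n) := by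
  intro f E U hf hV hE hr
  obtain ⟨r, hr0, hrlim, hres⟩ := hr
  set Uf : UnitAddTorus (Fin 3) → EuclideanSpace ℝ (Fin 3) :=
    ((U : Lp (EuclideanSpace ℝ (Fin 3)) 2 (volume : Measure (UnitAddTorus (Fin 3)))) :
      UnitAddTorus (Fin 3) → EuclideanSpace ℝ (Fin 3)) with hUf
  /- Step 1: truncation orders `N n` with `r (N n) < 1/(n+1)²`; parameters `M n`, `a n`. -/
  have hex : ∀ n : ℕ, ∃ N : ℕ, r N < 1 / ((n : ℝ) + 1) ^ 2 := fun n =>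
    (hrlim.eventually (gt_mem_nhds (by positivity))).exists
  choose N hN using hex
  have hgap : 0 < E - ‖U‖ ^ 2 := sub_pos.2 hE
  have hc₀pos : 0 < Real.sqrt ((E - ‖U‖ ^ 2) / 2) := Real.sqrt_pos.2 (by positivity)
  have hc₀sq : Real.sqrt ((E - ‖U‖ ^ 2) / 2) ^ 2 = (E - ‖U‖ ^ 2) / 2 := Real.sq_sqrt (by positivity)
  obtain ⟨M, a, hpar⟩ := dodger_parameters N hc₀pos
  have hNM : ∀ n : ℕ, N n < M n := fun n => (hpar n).1
  have ha_pos : ∀ n : ℕ, 0 < a n := fun n => (hpar n).2.1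
  /- Step 2: the wiggles `W n = W_{M n}` (part A) and the truncations `P n = P_{N n} U`. -/
  have hWex : ∀ n : ℕ, ∃ W : UnitAddTorus (Fin 3) → EuclideanSpace ℝ (Fin 3),
      Torus.IsSmooth W ∧ Torus.IsDivFree W ∧ Torus.HasZeroMean W ∧ (∀ x, ‖W x‖ ≤ Real.sqrt 2) ∧
      (∀ x, Torus.convect W W x = 0) ∧ ∫ x, ‖W x‖ ^ 2 = 1 ∧
      Torus.gradNormSq W = 4 * Real.pi ^ 2 * (M n : ℝ) ^ 2 ∧
      ∀ k : Fin 3 → ℤ, Torus.freqNormSq k ≠ (M n : ℝ) ^ 2 →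
        mFourierCoeff (EuclideanSpace.complexify ∘ W) k = 0 :=
    fun n => dodgerAssembly_partA (M n) (Nat.ne_zero_of_lt (hNM n))
  choose W hWs hWd hWz hWsup hWconv hWL2 hWgrad hWsupp using hWex
  set P : ℕ → UnitAddTorus (Fin 3) → EuclideanSpace ℝ (Fin 3) := fun n => Torus.fourierTruncate (N n) Uf
    with hPdef
  have hPadm : ∀ n : ℕ, Torus.IsSmooth (P n) ∧ Torus.IsDivFree (P n) ∧ Torus.HasZeroMean (P n) :=
    fun n => fourierTruncate_admissible U (N n)
  have hPL2 : ∀ n : ℕ, ∫ x, ‖P n x‖ ^ 2 ≤ ‖U‖ ^ 2 := fun n =>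
    integral_norm_sq_fourierTruncate_le_norm_sq U (N n)
  have hdisj : ∀ (n : ℕ) (k : Fin 3 → ℤ), mFourierCoeff (EuclideanSpace.complexify ∘ P n) k = 0 ∨
      mFourierCoeff (EuclideanSpace.complexify ∘ W n) k = 0 := fun n k => by
    by_cases hk : Torus.freqNormSq k = (M n : ℝ) ^ 2
    · refine Or.inl (mFourierCoeff_fourierTruncate_eq_zero U ?_)
      rw [hk]
      exact_mod_cast Nat.pow_lt_pow_left (hNM n) two_ne_zero
    · exact Or.inr (hWsupp n k hk)
  /- Step 3: the fields `u n = P n + a n • W n`: energy, enstrophy, residual bounds. -/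
  set u : ℕ → UnitAddTorus (Fin 3) → EuclideanSpace ℝ (Fin 3) := fun n x => P n x + a n • W n x
    with hudef
  have hEn : ∀ n : ℕ, ∫ x, ‖u n x‖ ^ 2 = (∫ x, ‖P n x‖ ^ 2) + a n ^ 2 := fun n => by
    show ∫ x, ‖P n x + a n • W n x‖ ^ 2 = _
    rw [integral_norm_sq_add_smul (hPadm n).1.continuous (hWs n).continuous,
      integral_inner_eq_zero_of_disjoint ((hPadm n).1.memLp 2) ((hWs n).memLp 2) (hdisj n), hWL2 n]
    ring
  have hG : ∀ n : ℕ, Torus.gradNormSq (u n) =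
      Torus.gradNormSq (P n) + a n ^ 2 * (4 * Real.pi ^ 2 * (M n : ℝ) ^ 2) := fun n => by
    show Torus.gradNormSq (fun x => P n x + a n • W n x) = _
    rw [gradNormSq_add_smul (hPadm n).1 (hWs n),
      integral_sum_inner_partialDeriv_eq_zero_of_disjoint (hPadm n).1 (hWs n) (hdisj n), hWgrad n]
    ring
  have hRes : ∀ (n : ℕ) (w : UnitAddTorus (Fin 3) → EuclideanSpace ℝ (Fin 3)), Torus.IsSmooth w →
      Torus.IsDivFree w → Torus.HasZeroMean w →
      |∫ x, inner ℝ (Torus.convect (u n) (u n) x - f x) (w x)| ≤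
        (r (N n) + 2 * (Real.sqrt 2 * Real.sqrt 3 * ‖U‖) * a n) * Real.sqrt (Torus.gradNormSq w) :=
    fun n w hw hwd hw0 => by
    have h := dodgerAssembly_partB (P n) (W n) f w (a n) (Real.sqrt 2) (hPadm n).1 (hWs n) hf hw
      (hPadm n).2.1 (hWd n) (hWconv n) (hWsup n) (ha_pos n).le (Real.sqrt_nonneg 2)
    have h1 : |∫ x, inner ℝ (Torus.convect (P n) (P n) x - f x) (w x)| ≤
        r (N n) * Real.sqrt (Torus.gradNormSq w) := hres (N n) w hw hwd hw0
    have hPU : Real.sqrt (∫ x, ‖P n x‖ ^ 2) ≤ ‖U‖ := by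
      rw [← Real.sqrt_sq (norm_nonneg U)]
      exact Real.sqrt_le_sqrt (hPL2 n)
    have h3G : Real.sqrt (3 * Torus.gradNormSq w) = Real.sqrt 3 * Real.sqrt (Torus.gradNormSq w) :=
      Real.sqrt_mul (by norm_num) _
    have ha2 : 0 ≤ 2 * a n * Real.sqrt 2 := by have := ha_pos n; positivity
    have hcross : 2 * a n * Real.sqrt 2 * Real.sqrt (∫ x, ‖P n x‖ ^ 2) *
        Real.sqrt (3 * Torus.gradNormSq w) ≤
        2 * a n * Real.sqrt 2 * ‖U‖ * (Real.sqrt 3 * Real.sqrt (Torus.gradNormSq w)) := by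
      rw [h3G]
      exact mul_le_mul (mul_le_mul_of_nonneg_left hPU ha2) le_rfl (by positivity) (by positivity)
    calc |∫ x, inner ℝ (Torus.convect (u n) (u n) x - f x) (w x)|
        ≤ |∫ x, inner ℝ (Torus.convect (P n) (P n) x - f x) (w x)| +
          2 * a n * Real.sqrt 2 * Real.sqrt (∫ x, ‖P n x‖ ^ 2) * Real.sqrt (3 * Torus.gradNormSq w) := h
      _ ≤ r (N n) * Real.sqrt (Torus.gradNormSq w) +
          2 * a n * Real.sqrt 2 * ‖U‖ * (Real.sqrt 3 * Real.sqrt (Torus.gradNormSq w)) :=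
          add_le_add h1 hcross
      _ = (r (N n) + 2 * (Real.sqrt 2 * Real.sqrt 3 * ‖U‖) * a n) * Real.sqrt (Torus.gradNormSq w) := by
          ring
  /- Step 4: rates. -/
  obtain ⟨hR0, hRlim, hRGlim, hdiv⟩ := dodger_rates (ρ := fun n => r (N n)) (a := a)
    (p := fun n => a n * M n) (G := fun n => Torus.gradNormSq (u n))
    (C := Real.sqrt 2 * Real.sqrt 3 * ‖U‖) (GU := (Torus.eGradNormSq Uf).toReal)
    (m₀ := min 1 (Real.sqrt ((E - ‖U‖ ^ 2) / 2))) (by positivity) ENNReal.toReal_nonneg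
    (lt_min one_pos hc₀pos) (fun n => hr0 _) (fun n => (hN n).le) ha_pos (fun n => (hpar n).2.2.2.1)
    (fun n => (hpar n).2.2.2.2.1) (fun n => (hpar n).2.2.2.2.2)
    (fun n => by rw [hG n]; nlinarith [Torus.gradNormSq_nonneg (P n)])
    (fun n => by rw [hG n]; nlinarith [gradNormSq_fourierTruncate_le hV (N n)])
  refine ⟨u, fun n => r (N n) + 2 * (Real.sqrt 2 * Real.sqrt 3 * ‖U‖) * a n, fun n => ?_, hRlim,
    hRGlim, hdiv⟩
  refine ⟨(hPadm n).1.add ((hWs n).smul (a n)),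
    isDivFree_add_smul ((hPadm n).1.isContDiff (by simp)) ((hWs n).isContDiff (by simp))
      (hPadm n).2.1 (hWd n) (a n),
    hasZeroMean_add_smul (hPadm n).1.integrable (hWs n).integrable (hPadm n).2.2 (hWz n) (a n),
    ?_, hR0 n, hRes n⟩
  rw [hEn n]
  have h2 : a n ^ 2 ≤ Real.sqrt ((E - ‖U‖ ^ 2) / 2) ^ 2 :=
    pow_le_pow_left₀ (ha_pos n).le ((hpar n).2.2.1) 2
  linarith [hPL2 n]

end Summit.AnomalousDissipation.AnomalousDissipation.Theorems.SteadyStatesLoudBounded.DodgerAssembly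

end
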